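import Literature.MathematicalPhysics.QuantumFieldTheory.Balaban1983to89.BetaDerivClause
import Literature.MathematicalPhysics.QuantumFieldTheory.Balaban1983to89.Node00.Sect2FormOfRecord

/-!
# F3 (idea-4 g4) — format sufficiency of the route's typed (B) for K2⁷'s last step, and the RUN-WISE derivative letter L¹ᵤ(run)

Crux of record: `stmt-QuantumFields-20543` = `Summit.QuantumFields.YangMills.Theses.BalabanUVNodes.EndpointGivenBR13SepCoPH`
(route `route-QuantumFields-BalabanUVNodes`).  Companion of the workfile `F3-FORMAT-SUFFICIENCY-idea4g4.md` and of card
`Ideas/runs-given-b.md` EDITION 4.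

§0  The law behind the route's binder `hB : B16.EndStatementBPrinted (datum).C` — at the datum `Sect2Form k ↔ HasSect2FormAEZS …`
    (`Node00.Record13SepCoPH.sect2Form_stage13SepCoPH_iff`), whose law is `Node00.Sect2.LawsRT` — is DEFINITIONALLY
    `Step.LFHyp ∧ B14.Eq227LocalizedTerms.LFHypAnalytic` ([Balaban1988Convergent] (2.27)(i)–(iv), (2.28), (2.31), (2.41)–(2.42)):
    pointwise-in-`g` bounds and FIELD-holomorphy on `U^c_j(X, α_{0,j}, α_{1,j})` with the `g`-dependent radii (2.28).  Neither
    structure has a field quantifying a `g`-derivative, a `g`-modulus or the value at `g = 0` of a term or of `β`: the typed (B)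
    is β-SILENT.  ([Balaban1987RG1] p. 263 «C^∞-function of g_{j−1} ∈ [0, γ]» + ABSOLUTE radii α₀, α₁ and p. 264 «smooth …
    uniformly bounded on this interval together with all derivatives» live elsewhere in the tree: `Step.SFHyp.betaSmooth`,
    `B12BetaAsPrinted.Conclusions.c264` — predicates, asserted nowhere, and not conjuncts of `B16.EndStatementBPrinted`.)
§1  The honest residual letter of the `runs-given-b` line, RUN-WISE: `RunLastVarDerivBound β C γ₀` (one constant `C` for all
    scales AND all runs in the window) = the run-restriction of the cell's `BetaDerivClause.LastVarDerivBound` (box-wide; «no such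
    uniformity is printed», GAPS G-adv2-3 (b), G-b12-2).  Mean value theorem ⇒ `RunLipschitzAtZero`; with the ENDPOINT
    IDENTIFICATION `EndpointId β b` (β_{k+1}(g₀,…,g_{k−1},0) = b_{k+1}, history-free: [Balaban1987RG1] (1.3) p. 260 + (2.13)–(2.14)
    p. 268 «vanishes at g_k = 0»; tree `B12Beta.OneLoopSplit`, `B12BetaAsPrinted.pol_Eint_eq_of_lastZero`) ⇒ the constant-form
    currency `RunConstRemainder β b (C·γ₀) γ₀` of `RunsGivenBSketch3` §2 (restated verbatim below).  Box letter ⇒ run letter.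

HONEST FRAMING: elementary real analysis (MVT) over the typed flow `FlowStep`; two hypothesis SHAPES; NOTHING of Bałaban's
analysis is proved or its price lowered; K2⁷ is NOT proved; NODE O = [Balaban1987RG1] Thm 2 ∕ (0.31) p. 259 is UNPROVED IN PRINT;
route R4 `BalabanUVNodes` decides only the CONDITIONAL finite-𝕋⁴ rung `BalabanLadder.UV` — not the continuum limit, not OS,
NOT the Yang–Mills mass gap (Clay).  No `sorry`, no `axiom`.
-/

namespace Summit.QuantumFields.YangMills.Cruxes.EndpointGivenBR13SepCoPH.RunsGivenB4

open Literature.MathematicalPhysics.QuantumFieldTheory.Balaban1983to89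
open FlowStep

noncomputable section

/-! ## §0  What the route's `hB` format is, definitionally (β-silence is read off the two structures' field lists) -/

section FormatSilence

open Step T4Continuum B14.Eq227LocalizedTerms Node00

variable {P : Params} {G : Type*} [GaugeGroup G] {Φ 𝒢 𝔄 : Type*} [NormedAddCommGroup Φ] [NormedSpace ℂ Φ]

/-- F3 §0: the inductive-assumption law of the [B16]∕[III] format carried by `hB` is `LFHyp ∧ LFHypAnalytic` — by `Iff.rfl`.
`LFHyp`'s fields: `rg, localDepE, localDepR, boundE, boundR, boundB, gaugeInvE, gaugeInvR` (radii `c.alpha0 (T.flow.g j)`,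
`c.alpha1 (T.flow.g j)` = (2.28)); `LFHypAnalytic`: `AnalyticOnNhd ℂ` in the FIELD variable at each fixed `g`.  No `g`-regularity. -/
theorem lawsRT_iff (T : LFTower P G Φ 𝒢 𝔄) (c : LFConsts) (k : ℕ) :
    Sect2.LawsRT T c k ↔ (LFHyp T c k ∧ LFHypAnalytic T c k) := Iff.rfl

end FormatSilence

/-! ## §1  The run-wise derivative letter, MVT, endpoint identification ⇒ constant-form closeness along runs -/

/-- **L¹ᵤ(run)** — RUN-WISE LAST-VARIABLE DERIVATIVE BOUND, ONE constant `C` for every scale `k ≤ n` of every run `gs` of the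
flow `β` ((0.20): `RGEqH n β gs`) staying in the window (`Step.InInterval γ₀ n gs`): `g ↦ β_{k+1}(g₀,…,g_{k−1}, g)` is
differentiable within `[0, γ₀]` with `|∂β_{k+1}∕∂g_k| ≤ C`.  The run-restriction of `BetaDerivClause.LastVarDerivBound`
(box-wide).  HYPOTHESIS SHAPE: p. 264's clause made uniform in `j` and across runs — the uniformity is NOT PRINTED
(GAPS G-adv2-3 (b), G-b12-2; `T4FlagMemoryTwoRun` «one ℓ′ for all j NOT PRINTED»). -/
def RunLastVarDerivBound (β : HBeta) (C γ₀ : ℝ) : Prop :=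
  ∀ (n : ℕ) (gs : ℕ → ℝ), RGEqH n β gs → Step.InInterval γ₀ n gs → ∀ k, k ≤ n →
    ∃ f' : ℝ → ℝ,
      (∀ g ∈ Set.Icc (0 : ℝ) γ₀,
        HasDerivWithinAt (fun g : ℝ => β k (Function.update (prefixOf gs k) (Fin.last k) g)) (f' g)
          (Set.Icc (0 : ℝ) γ₀) g) ∧
      ∀ g ∈ Set.Icc (0 : ℝ) γ₀, |f' g| ≤ C

/-- RUN-WISE LIPSCHITZ AT ZERO in the last variable: along every in-window run, `|β_{k+1}(g₀,…,g_k) − β_{k+1}(g₀,…,g_{k−1},0)| ≤ C·g_k`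
(the run-restriction of `BetaDerivClause.LastVarLipschitzAtZero`). -/
def RunLipschitzAtZero (β : HBeta) (C γ₀ : ℝ) : Prop :=
  ∀ (n : ℕ) (gs : ℕ → ℝ), RGEqH n β gs → Step.InInterval γ₀ n gs → ∀ k, k ≤ n →
    |β k (prefixOf gs k) - β k (Function.update (prefixOf gs k) (Fin.last k) 0)| ≤ C * gs k

/-- **(E) ENDPOINT IDENTIFICATION**: at `g_k = 0` the β-function is the HISTORY-FREE number `b_{k+1}` — the printed one-loop
split read at the endpoint ([Balaban1987RG1] (1.3): `log Z^{(j)}` carries no coupling; (2.13)–(2.14): the interaction term's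
exponent «vanishes at g_k = 0»; tree: `B12Beta.OneLoopSplit` with `β⁰ = b`, `B12BetaAsPrinted.pol_Eint_eq_of_lastZero`).
A hypothesis shape here (its instance at the datum's `βfun` and DEF-1's named jets `θ.cβ • beta0OfJs F κ` is the readout
identity R2 of the card). -/
def EndpointId (β : HBeta) (b : ℕ → ℝ) : Prop :=
  ∀ (k : ℕ) (p : Fin (k + 1) → ℝ), p (Fin.last k) = 0 → β k p = b k

/-- `RunsGivenBSketch3` §2's constant-form run-wise closeness letter, VERBATIM: along every in-window run, `|β_{k+1} − b_{k+1}| ≤ r`. -/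
def RunConstRemainder (β : HBeta) (b : ℕ → ℝ) (r γ₀ : ℝ) : Prop :=
  ∀ (n : ℕ) (gs : ℕ → ℝ), RGEqH n β gs → Step.InInterval γ₀ n gs → ∀ k, k ≤ n → |β k (prefixOf gs k) - b k| ≤ r

/-- **(M) = MEAN VALUE THEOREM, run-wise**: `RunLastVarDerivBound ⇒ RunLipschitzAtZero` with the same constant
(`Convex.norm_image_sub_le_of_norm_hasDerivWithin_le` on `[0, γ₀]` between `0` and `g_k`). [folklore] -/
theorem runLipschitzAtZero_of_runLastVarDerivBound {β : HBeta} {C γ₀ : ℝ} (h : RunLastVarDerivBound β C γ₀) :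
    RunLipschitzAtZero β C γ₀ := by
  intro n gs hrg hI k hk
  obtain ⟨f', hf', hb⟩ := h n gs hrg hI k hk
  have hgk : 0 < gs k ∧ gs k ≤ γ₀ := hI k hk
  have h0 : (0 : ℝ) ∈ Set.Icc (0 : ℝ) γ₀ := ⟨le_rfl, hgk.1.le.trans hgk.2⟩
  have hg : gs k ∈ Set.Icc (0 : ℝ) γ₀ := ⟨hgk.1.le, hgk.2⟩
  have key := (convex_Icc (0 : ℝ) γ₀).norm_image_sub_le_of_norm_hasDerivWithin_le
    (f := fun g : ℝ => β k (Function.update (prefixOf gs k) (Fin.last k) g)) (f' := f')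
    (fun x hx => hf' x hx) (fun x hx => by simpa [Real.norm_eq_abs] using hb x hx) h0 hg
  have hupd : Function.update (prefixOf gs k) (Fin.last k) (gs k) = prefixOf gs k := by
    have hl : prefixOf gs k (Fin.last k) = gs k := by simp
    rw [← hl, Function.update_eq_self]
  have key' : |β k (prefixOf gs k) - β k (Function.update (prefixOf gs k) (Fin.last k) 0)| ≤ C * |gs k| := by
    simpa [hupd, Real.norm_eq_abs] using key
  simpa [abs_of_pos hgk.1] using key'

/-- **PRICING: box letter ⇒ run letter.**  The cell's box-wide `BetaDerivClause.LastVarDerivBound β C γ` (every history in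
`]0, γ]^{k+1}`) implies L¹ᵤ(run) on every window `γ₀ ≤ γ` — the run letter is the WEAKER ask (BN-F ∕ CRIT-2 2e: run-keying is
print-faithful; box-wide letters over-ask the supplier). [folklore] -/
theorem runLastVarDerivBound_of_box {β : HBeta} {C γ γ₀ : ℝ} (h : BetaDerivClause.LastVarDerivBound β C γ) (hγ₀ : γ₀ ≤ γ) :
    RunLastVarDerivBound β C γ₀ := by
  intro n gs _hrg hI k hk
  have hbox : prefixOf gs k ∈ B12Beta.HistBox γ k := by
    intro i
    have hi : (i : ℕ) ≤ n := le_trans (Nat.lt_succ_iff.mp i.is_lt) hk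
    have := hI i hi
    exact ⟨by simpa using this.1, by simpa using this.2.trans hγ₀⟩
  obtain ⟨f', hf', hb⟩ := h k (prefixOf gs k) hbox
  refine ⟨f', fun g hg => (hf' g ⟨hg.1, hg.2.trans hγ₀⟩).mono (Set.Icc_subset_Icc_right hγ₀),
    fun g hg => hb g ⟨hg.1, hg.2.trans hγ₀⟩⟩

/-- **(E) + (M) ⇒ the card's (D4)-side currency in CONSTANT form along runs**: endpoint identification and run-wise Lipschitz at
zero give `|β_{k+1}(g₀,…,g_k) − b_{k+1}| ≤ C·g_k ≤ C·γ₀` along every in-window run, i.e. `RunConstRemainder β b (C·γ₀) γ₀`; the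
supplier then meets the drawdown cap `r ≤ θ.cβ·stepBal 2 F.L` of `RunRemAt` by choosing the window `γ₀` small. [folklore] -/
theorem runConstRemainder_of_endpointId_of_runLipschitzAtZero {β : HBeta} {b : ℕ → ℝ} {C γ₀ : ℝ}
    (hE : EndpointId β b) (hL : RunLipschitzAtZero β C γ₀) (hC : 0 ≤ C) :
    RunConstRemainder β b (C * γ₀) γ₀ := by
  intro n gs hrg hI k hk
  have hgk : 0 < gs k ∧ gs k ≤ γ₀ := hI k hk
  have h1 := hL n gs hrg hI k hk
  have h0 : β k (Function.update (prefixOf gs k) (Fin.last k) 0) = b k := hE k _ (by simp)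
  rw [h0] at h1
  exact h1.trans (mul_le_mul_of_nonneg_left hgk.2 hC)

/-- The composed road, for the record: L¹ᵤ(run) + (E) ⇒ constant-form run-wise closeness with `r = C·γ₀`. [folklore] -/
theorem runConstRemainder_of_endpointId_of_runLastVarDerivBound {β : HBeta} {b : ℕ → ℝ} {C γ₀ : ℝ}
    (hE : EndpointId β b) (hD : RunLastVarDerivBound β C γ₀) (hC : 0 ≤ C) :
    RunConstRemainder β b (C * γ₀) γ₀ :=
  runConstRemainder_of_endpointId_of_runLipschitzAtZero hE (runLipschitzAtZero_of_runLastVarDerivBound hD) hC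

/-- … and from the cell's BOX letter (pricing: the run road asks no more than the box road). [folklore] -/
theorem runConstRemainder_of_endpointId_of_box {β : HBeta} {b : ℕ → ℝ} {C γ γ₀ : ℝ}
    (hE : EndpointId β b) (h : BetaDerivClause.LastVarDerivBound β C γ) (hγ₀ : γ₀ ≤ γ) (hC : 0 ≤ C) :
    RunConstRemainder β b (C * γ₀) γ₀ :=
  runConstRemainder_of_endpointId_of_runLastVarDerivBound hE (runLastVarDerivBound_of_box h hγ₀) hC

end

end Summit.QuantumFields.YangMills.Cruxes.EndpointGivenBR13SepCoPH.RunsGivenB4
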